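import Literature.NumberTheory.LFunctions.WeilZeroSum
import Literature.NumberTheory.LFunctions.ZetaZerosReflection
import HarnessLib

/-!
# Sums over the non-trivial zeros against majorants depending on the ordinate

Topic `Literature/NumberTheory/LFunctions`. Everything in this file is PROVED (no definitions, no
named facts).

The local count `N(c + 1/2) − N(c − 1/2) ≪ log(|c| + 2)` (Montgomery–Vaughan Thm. 10.13, in the
tree as `Literature.NumberTheory.LFunctions.exists_sum_zetaZeroWindow_le` for the zeros with
`β ≥ 1/4`) is extended to all non-trivial zeros by the reflection `ρ ↦ 1 − ρ̄`
(`sum_le_of_abs_im_sub_le`), and turned into the working tool of the `L¹` theory of `S(t+h) − S(t)`: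
if `0 ≤ g(ρ) ≤ ψ(round γ)` on the zeros then `∑_ρ m(ρ) g(ρ) ≤ C_w ∑_k ψ(k) log(|k| + 2)` over
any finite set of integers containing the rounded ordinates (`sum_mul_le_of_ordinate_majorant`),
whence `tsum` bounds (`tsum_mul_le_of_ordinate_majorant`), and the shell estimate
`∑_k log(|k|+2)/max(|k − u|, R)² ≤ 40 (log(|u|+2) + 2)/√R` (`sum_log_div_max_sq_le`).

## References

* H. L. Montgomery, R. C. Vaughan, *Multiplicative Number Theory I* (2007), Thm. 10.13.
  [cite: MontgomeryVaughan2007, Thm. 10.13]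
* E. C. Titchmarsh, *The Theory of the Riemann Zeta-Function*, 2nd ed. (1986), §9.2, Thm. 9.2.
-/

noncomputable section

open Complex Real Set Finset
open scoped ComplexConjugate

namespace Literature.NumberTheory.LFunctions.ZeroOrdinateSums

/-! ### The local count for all non-trivial zeros -/

/-- **Local count of all the non-trivial zeros**: there is `C_w > 0` such that for every real `c`
and every finite set `F` of non-trivial zeros with `|Im ρ − c| ≤ 1/2`,
`∑_{ρ ∈ F} m(ρ) ≤ C_w log(|c| + 2)`. [cite: MontgomeryVaughan2007, Thm. 10.13] -/
theorem exists_sum_le_of_abs_im_sub_le : ∃ C : ℝ, 0 < C ∧ ∀ (c : ℝ) (F : Finset ℂ),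
    (∀ ρ ∈ F, ρ ∈ ZetaZeros.riemannZetaNontrivialZeros ∧ |ρ.im - c| ≤ 1 / 2) →
    ∑ ρ ∈ F, (riemannZetaZeroOrder ρ : ℝ) ≤ C * Real.log (|c| + 2) := by
  obtain ⟨C, hC0, hC⟩ := exists_sum_zetaZeroWindow_le
  refine ⟨2 * C, by positivity, fun c F hF => ?_⟩
  have hlog : 0 ≤ Real.log (|c| + 2) := Real.log_nonneg (by linarith [abs_nonneg c])
  -- split `F` by `β ≥ 1/4`
  rw [← Finset.sum_filter_add_sum_filter_not F (fun ρ => 1 / 4 ≤ ρ.re)]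
  have hW := hC c
  set W := (zetaZeroWindow_finite c).toFinset with hWdef
  have hnn : ∀ ρ ∈ W, (0 : ℝ) ≤ riemannZetaZeroOrder ρ := fun ρ hρ => by
    rw [hWdef, Set.Finite.mem_toFinset] at hρ; exact riemannZetaZeroOrder_nonneg_of_zero hρ.1
  -- right part ⊆ window
  have h1 : ∑ ρ ∈ F.filter (fun ρ => 1 / 4 ≤ ρ.re), (riemannZetaZeroOrder ρ : ℝ) ≤ C * Real.log (|c| + 2) := by
    refine (Finset.sum_le_sum_of_subset_of_nonneg (fun ρ hρ => ?_) (fun ρ hρ _ => hnn ρ hρ)).trans hW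
    rw [Finset.mem_filter] at hρ
    rw [hWdef, Set.Finite.mem_toFinset]
    exact ⟨ZetaZeros.riemannZetaNontrivialZeros.zeta_eq_zero (hF ρ hρ.1).1, hρ.2, (hF ρ hρ.1).2⟩
  -- left part: reflect
  have h2 : ∑ ρ ∈ F.filter (fun ρ => ¬ 1 / 4 ≤ ρ.re), (riemannZetaZeroOrder ρ : ℝ) ≤ C * Real.log (|c| + 2) := by
    set G := F.filter (fun ρ => ¬ 1 / 4 ≤ ρ.re) with hG
    have hinj : Set.InjOn (fun ρ : ℂ => 1 - conj ρ) G := by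
      intro a _ b _ hab
      have := congrArg (fun z => conj (1 - z)) hab
      simpa using this
    have heq : ∑ ρ ∈ G, (riemannZetaZeroOrder ρ : ℝ) = ∑ ρ ∈ G, (riemannZetaZeroOrder (1 - conj ρ) : ℝ) := by
      refine Finset.sum_congr rfl fun ρ hρ => ?_
      rw [hG, Finset.mem_filter] at hρ
      have hz := (hF ρ hρ.1).1
      rw [riemannZetaZeroOrder_one_sub_conj (ZetaZeros.riemannZetaNontrivialZeros.re_pos hz)
        (ZetaZeros.riemannZetaNontrivialZeros.re_lt_one hz)]
    rw [heq, ← Finset.sum_image (f := fun w : ℂ => (riemannZetaZeroOrder w : ℝ)) hinj]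
    refine (Finset.sum_le_sum_of_subset_of_nonneg (fun w hw => ?_) (fun ρ hρ _ => hnn ρ hρ)).trans hW
    rw [Finset.mem_image] at hw
    obtain ⟨ρ, hρ, rfl⟩ := hw
    rw [hG, Finset.mem_filter] at hρ
    have hz := (hF ρ hρ.1).1
    have hmem := ZetaZeros.riemannZetaNontrivialZeros.one_sub_conj_mem hz
    rw [hWdef, Set.Finite.mem_toFinset]
    refine ⟨ZetaZeros.riemannZetaNontrivialZeros.zeta_eq_zero hmem, ?_, ?_⟩
    · simp; push Not at hρ; linarith [hρ.2]
    · simpa using (hF ρ hρ.1).2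
  linarith

/-! ### Sums against ordinate majorants -/

/-- **Zero sums against an ordinate majorant, finite form**: with `C_w` as above, if
`0 ≤ g(ρ) ≤ ψ(round(Im ρ))` on the non-trivial zeros of a finite set `F` and `ψ ≥ 0`, then
`∑_{ρ∈F} m(ρ) g(ρ) ≤ C_w ∑_{k ∈ round(Im F)} ψ(k) log(|k|+2)`. [folklore] -/
theorem sum_mul_le_of_ordinate_majorant {C : ℝ}
    (hC : ∀ (c : ℝ) (F : Finset ℂ), (∀ ρ ∈ F, ρ ∈ ZetaZeros.riemannZetaNontrivialZeros ∧ |ρ.im - c| ≤ 1 / 2) →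
      ∑ ρ ∈ F, (riemannZetaZeroOrder ρ : ℝ) ≤ C * Real.log (|c| + 2))
    {g : ℂ → ℝ} {ψ : ℤ → ℝ} (hψ : ∀ k, 0 ≤ ψ k) (F : Finset ℂ)
    (hF : ∀ ρ ∈ F, ρ ∈ ZetaZeros.riemannZetaNontrivialZeros) (hg : ∀ ρ ∈ F, g ρ ≤ ψ (round ρ.im)) :
    ∑ ρ ∈ F, (riemannZetaZeroOrder ρ : ℝ) * g ρ ≤
      C * ∑ k ∈ F.image (fun ρ => round ρ.im), ψ k * Real.log (|(k : ℝ)| + 2) := by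
  rw [← Finset.sum_fiberwise_of_maps_to (g := fun ρ : ℂ => round ρ.im)
      (fun ρ hρ => Finset.mem_image_of_mem (fun ρ : ℂ => round ρ.im) hρ), Finset.mul_sum]
  refine Finset.sum_le_sum fun k hk => ?_
  have hm : ∀ ρ ∈ F, (0 : ℝ) ≤ riemannZetaZeroOrder ρ := fun ρ hρ =>
    riemannZetaZeroOrder_nonneg_of_zero (ZetaZeros.riemannZetaNontrivialZeros.zeta_eq_zero (hF ρ hρ))
  calc ∑ ρ ∈ F.filter (fun ρ => round ρ.im = k), (riemannZetaZeroOrder ρ : ℝ) * g ρ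
      ≤ ∑ ρ ∈ F.filter (fun ρ => round ρ.im = k), (riemannZetaZeroOrder ρ : ℝ) * ψ k := by
        refine Finset.sum_le_sum fun ρ hρ => ?_
        rw [Finset.mem_filter] at hρ
        rw [← hρ.2]
        exact mul_le_mul_of_nonneg_left (hg ρ hρ.1) (hm ρ hρ.1)
    _ = ψ k * ∑ ρ ∈ F.filter (fun ρ => round ρ.im = k), (riemannZetaZeroOrder ρ : ℝ) := by
        rw [Finset.mul_sum]; refine Finset.sum_congr rfl fun _ _ => mul_comm _ _
    _ ≤ ψ k * (C * Real.log (|(k : ℝ)| + 2)) := by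
        refine mul_le_mul_of_nonneg_left (hC k _ fun ρ hρ => ?_) (hψ k)
        rw [Finset.mem_filter] at hρ
        refine ⟨hF ρ hρ.1, ?_⟩
        rw [← hρ.2]
        exact abs_sub_round ρ.im
    _ = C * (ψ k * Real.log (|(k : ℝ)| + 2)) := by ring

/-- **Zero sums against an ordinate majorant, `tsum` form**: if `0 ≤ g ≤ ψ ∘ round ∘ Im` on the
non-trivial zeros, `ψ ≥ 0`, and the finite sums `∑_{k∈K} ψ(k) log(|k|+2)` are bounded by `Ψ`, then
`∑_ρ m(ρ) g(ρ)` converges and is `≤ C_w Ψ`. [folklore] -/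
theorem tsum_mul_le_of_ordinate_majorant {C : ℝ} (hC0 : 0 ≤ C)
    (hC : ∀ (c : ℝ) (F : Finset ℂ), (∀ ρ ∈ F, ρ ∈ ZetaZeros.riemannZetaNontrivialZeros ∧ |ρ.im - c| ≤ 1 / 2) →
      ∑ ρ ∈ F, (riemannZetaZeroOrder ρ : ℝ) ≤ C * Real.log (|c| + 2))
    {g : ℂ → ℝ} {ψ : ℤ → ℝ} {Ψ : ℝ} (hψ : ∀ k, 0 ≤ ψ k)
    (hg0 : ∀ ρ ∈ ZetaZeros.riemannZetaNontrivialZeros, 0 ≤ g ρ)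
    (hg : ∀ ρ ∈ ZetaZeros.riemannZetaNontrivialZeros, g ρ ≤ ψ (round ρ.im))
    (hΨ : ∀ K : Finset ℤ, ∑ k ∈ K, ψ k * Real.log (|(k : ℝ)| + 2) ≤ Ψ) :
    Summable (fun ρ : ZetaZeros.riemannZetaNontrivialZeros => (riemannZetaZeroOrder (ρ : ℂ) : ℝ) * g ρ) ∧
    ∑' ρ : ZetaZeros.riemannZetaNontrivialZeros, (riemannZetaZeroOrder (ρ : ℂ) : ℝ) * g ρ ≤ C * Ψ := by
  have hnn : 0 ≤ fun ρ : ZetaZeros.riemannZetaNontrivialZeros => (riemannZetaZeroOrder (ρ : ℂ) : ℝ) * g ρ := by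
    intro ρ
    exact mul_nonneg (riemannZetaZeroOrder_nonneg_of_zero (ZetaZeros.riemannZetaNontrivialZeros.zeta_eq_zero ρ.2))
      (hg0 ρ ρ.2)
  have hbd : ∀ s : Finset ZetaZeros.riemannZetaNontrivialZeros,
      ∑ ρ ∈ s, (riemannZetaZeroOrder (ρ : ℂ) : ℝ) * g ρ ≤ C * Ψ := by
    intro s
    have h := sum_mul_le_of_ordinate_majorant hC hψ (s.image (fun ρ : ZetaZeros.riemannZetaNontrivialZeros => (ρ : ℂ)))
      (fun ρ hρ => by obtain ⟨ρ', -, rfl⟩ := Finset.mem_image.1 hρ; exact ρ'.2)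
      (fun ρ hρ => by obtain ⟨ρ', -, rfl⟩ := Finset.mem_image.1 hρ; exact hg _ ρ'.2)
    rw [Finset.sum_image (fun a _ b _ hab => Subtype.ext hab)] at h
    exact h.trans (mul_le_mul_of_nonneg_left (hΨ _) hC0)
  exact ⟨summable_of_sum_le hnn hbd, Real.tsum_le_of_sum_le hnn hbd⟩

/-! ### The shell estimate `∑_k log(|k|+2)/max(|k−u|, R)² ≪ log(|u|+2)/√R` -/

/-- `log(x + 2) ≤ 2 √x` for `x ≥ 1`. [folklore] -/
theorem log_add_two_le_two_sqrt {x : ℝ} (hx : 1 ≤ x) : Real.log (x + 2) ≤ 2 * Real.sqrt x := by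
  have hs : 1 ≤ Real.sqrt x := by rw [Real.le_sqrt (by norm_num) (by linarith)]; simpa
  have hx' : x = Real.sqrt x ^ 2 := (Real.sq_sqrt (by linarith)).symm
  -- `log(x+2) ≤ log(3x) = log 3 + 2 log √x ≤ 1.1 + 2(√x − 1)`
  have h1 : Real.log (x + 2) ≤ Real.log (3 * x) := Real.log_le_log (by linarith) (by linarith)
  have h2 : Real.log (3 * x) = Real.log 3 + 2 * Real.log (Real.sqrt x) := by
    rw [Real.log_mul (by norm_num) (by linarith)]
    conv_lhs => rw [hx']
    rw [Real.log_pow]; push_cast; ring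
  have h3 : Real.log (Real.sqrt x) ≤ Real.sqrt x - 1 := Real.log_le_sub_one_of_pos (by linarith)
  have h4 : Real.log 3 < 1.11 := by
    have he := Real.exp_one_gt_d9
    have h5 : Real.log 3 = 1 + Real.log (3 / Real.exp 1) := by
      rw [Real.log_div (by norm_num) (Real.exp_pos 1).ne', Real.log_exp]; ring
    have h6 : Real.log (3 / Real.exp 1) ≤ 3 / Real.exp 1 - 1 := Real.log_le_sub_one_of_pos (by positivity)
    have h7 : 3 / Real.exp 1 < 1.104 := by rw [div_lt_iff₀ (Real.exp_pos 1)]; linarith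
    linarith
  linarith

/-- The number of integers `k` with `|k − u| < R` is at most `2R + 1`. [folklore] -/
theorem card_filter_abs_sub_lt_le (K : Finset ℤ) (u R : ℝ) (hR : 0 ≤ R) :
    ((K.filter fun k : ℤ => |(k : ℝ) - u| < R).card : ℝ) ≤ 2 * R + 1 := by
  set S := K.filter fun k : ℤ => |(k : ℝ) - u| < R with hS
  have hsub : S ⊆ Finset.Ioo (⌊u - R⌋) (⌈u + R⌉) := by
    intro k hk
    rw [hS, Finset.mem_filter] at hk
    have := abs_lt.1 hk.2
    rw [Finset.mem_Ioo]
    constructor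
    · by_contra h; push Not at h
      have : (k : ℝ) ≤ ⌊u - R⌋ := by exact_mod_cast h
      linarith [Int.floor_le (u - R)]
    · by_contra h; push Not at h
      have : (⌈u + R⌉ : ℝ) ≤ k := by exact_mod_cast h
      linarith [Int.le_ceil (u + R)]
  have hcard := Finset.card_le_card hsub
  rw [Int.card_Ioo] at hcard
  have h1 : ((S.card : ℕ) : ℝ) ≤ ((⌈u + R⌉ - ⌊u - R⌋ - 1).toNat : ℝ) := by exact_mod_cast hcard
  refine h1.trans ?_
  have h2 : ((⌈u + R⌉ - ⌊u - R⌋ - 1 : ℤ) : ℝ) ≤ 2 * R + 1 := by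
    push_cast
    linarith [Int.ceil_lt_add_one (u + R), Int.lt_floor_add_one (u - R)]
  rcases le_or_gt 0 (⌈u + R⌉ - ⌊u - R⌋ - 1) with h | h
  · have e : (((⌈u + R⌉ - ⌊u - R⌋ - 1).toNat : ℕ) : ℝ) = ((⌈u + R⌉ - ⌊u - R⌋ - 1 : ℤ) : ℝ) := by
      have := Int.toNat_of_nonneg h; exact_mod_cast this
    rw [e]; exact h2
  · rw [Int.toNat_of_nonpos h.le]; simp; linarith

/-- Telescoping: `1/(j √j) ≤ 2 (1/√(j−1) − 1/√j)` for `j ≥ 2`. [folklore] -/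
theorem inv_mul_sqrt_le_telescope {j : ℝ} (hj : 2 ≤ j) :
    1 / (j * Real.sqrt j) ≤ 2 * (1 / Real.sqrt (j - 1) - 1 / Real.sqrt j) := by
  set a := Real.sqrt (j - 1) with ha
  set b := Real.sqrt j with hb
  have h0 : 0 < a := Real.sqrt_pos.2 (by linarith)
  have h1 : 0 < b := Real.sqrt_pos.2 (by linarith)
  have hs1 : a ^ 2 = j - 1 := Real.sq_sqrt (by linarith)
  have hs2 : b ^ 2 = j := Real.sq_sqrt (by linarith)
  have hle : a ≤ b := Real.sqrt_le_sqrt (by linarith)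
  have hdiff : (b - a) * (b + a) = 1 := by nlinarith
  have hd0 : 0 ≤ b - a := by linarith
  have hj' : j * b = b ^ 3 := by rw [← hs2]; ring
  rw [hj', div_sub_div _ _ h0.ne' h1.ne', one_mul, mul_one, div_le_iff₀ (by positivity)]
  rw [show 2 * ((b - a) / (a * b)) * b ^ 3 = 2 * b ^ 2 * (b - a) / a by field_simp]
  rw [le_div_iff₀ h0, one_mul]
  have h5 : a * (b + a) ≤ 2 * b ^ 2 := by nlinarith
  calc a = a * ((b - a) * (b + a)) := by rw [hdiff, mul_one]
    _ = (a * (b + a)) * (b - a) := by ring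
    _ ≤ 2 * b ^ 2 * (b - a) := mul_le_mul_of_nonneg_right h5 hd0

/-- `∑_{j=m}^{m-1+d} 1/(j√j) ≤ 2 (1/√(m−1) − 1/√(m−1+d))` for `2 ≤ m`. [folklore] -/
theorem sum_Icc_inv_mul_sqrt_le_aux {m : ℕ} (hm : 2 ≤ m) (d : ℕ) :
    ∑ j ∈ Finset.Icc m (m - 1 + d), 1 / ((j : ℝ) * Real.sqrt j) ≤
      2 * (1 / Real.sqrt ((m : ℝ) - 1) - 1 / Real.sqrt (((m - 1 + d : ℕ) : ℝ))) := by
  induction d with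
  | zero =>
    rw [Finset.Icc_eq_empty (by omega)]
    have e : (((m - 1 + 0 : ℕ)) : ℝ) = (m : ℝ) - 1 := by
      rw [Nat.add_zero, Nat.cast_sub (by omega)]; simp
    rw [e]; simp
  | succ d ih =>
    have htop : m ≤ m - 1 + (d + 1) := by omega
    rw [show m - 1 + (d + 1) = (m - 1 + d) + 1 by omega, Finset.sum_Icc_succ_top (by omega)]
    have hj : (2 : ℝ) ≤ ((m - 1 + d + 1 : ℕ) : ℝ) := by
      have : 2 ≤ m - 1 + d + 1 := by omega
      exact_mod_cast this
    have h2 := inv_mul_sqrt_le_telescope hj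
    have e : ((m - 1 + d + 1 : ℕ) : ℝ) - 1 = ((m - 1 + d : ℕ) : ℝ) := by push_cast; ring
    rw [e] at h2
    linarith

/-- `∑_{j=m}^{n} 1/(j√j) ≤ 2/√(m−1)` for `2 ≤ m`. [folklore] -/
theorem sum_Icc_inv_mul_sqrt_le {m n : ℕ} (hm : 2 ≤ m) :
    ∑ j ∈ Finset.Icc m n, 1 / ((j : ℝ) * Real.sqrt j) ≤ 2 / Real.sqrt ((m : ℝ) - 1) := by
  rcases lt_or_ge n m with h | h
  · rw [Finset.Icc_eq_empty (by omega)]; simp; positivity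
  · have := sum_Icc_inv_mul_sqrt_le_aux hm (n - (m - 1))
    rw [show m - 1 + (n - (m - 1)) = n by omega] at this
    have h3 : 0 ≤ 1 / Real.sqrt ((n : ℕ) : ℝ) := by positivity
    have e : 2 * (1 / Real.sqrt ((m : ℝ) - 1) - 1 / Real.sqrt ((n : ℕ) : ℝ)) =
        2 / Real.sqrt ((m : ℝ) - 1) - 2 * (1 / Real.sqrt ((n : ℕ) : ℝ)) := by ring
    rw [e] at this
    linarith

/-- Integers at distance `≥ 1` from `u` on the same side have distinct integer parts of the distance:
the fibres of `k ↦ ⌊|k − u|⌋` have at most two elements. [folklore] -/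
theorem card_filter_floor_eq_le_two (K : Finset ℤ) (u : ℝ) (j : ℕ) :
    (K.filter fun k : ℤ => ⌊|(k : ℝ) - u|⌋₊ = j).card ≤ 2 := by
  set F := K.filter fun k : ℤ => ⌊|(k : ℝ) - u|⌋₊ = j with hF
  have hinj : Set.InjOn (fun k : ℤ => decide (u ≤ (k : ℝ))) F := by
    intro a ha b hb hab
    rw [hF, Finset.coe_filter, Set.mem_setOf_eq] at ha hb
    simp only [decide_eq_decide] at hab
    by_contra hne
    -- WLOG `a < b`
    rcases lt_or_gt_of_ne hne with hlt | hlt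
    · have hab1 : (a : ℝ) + 1 ≤ b := by exact_mod_cast hlt
      by_cases hu : u ≤ (a : ℝ)
      · have hub : u ≤ (b : ℝ) := by linarith
        have e1 : |(a : ℝ) - u| + 1 ≤ |(b : ℝ) - u| := by
          rw [abs_of_nonneg (by linarith), abs_of_nonneg (by linarith)]; linarith
        have := Nat.floor_le_floor e1
        rw [Nat.floor_add_one (abs_nonneg _), ha.2, hb.2] at this
        omega
      · have hub : ¬ u ≤ (b : ℝ) := by rwa [← hab]
        push Not at hu hub
        have e1 : |(b : ℝ) - u| + 1 ≤ |(a : ℝ) - u| := by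
          rw [abs_of_neg (by linarith), abs_of_neg (by linarith)]; linarith
        have := Nat.floor_le_floor e1
        rw [Nat.floor_add_one (abs_nonneg _), ha.2, hb.2] at this
        omega
    · have hab1 : (b : ℝ) + 1 ≤ a := by exact_mod_cast hlt
      by_cases hu : u ≤ (b : ℝ)
      · have hua : u ≤ (a : ℝ) := by linarith
        have e1 : |(b : ℝ) - u| + 1 ≤ |(a : ℝ) - u| := by
          rw [abs_of_nonneg (by linarith), abs_of_nonneg (by linarith)]; linarith
        have := Nat.floor_le_floor e1
        rw [Nat.floor_add_one (abs_nonneg _), ha.2, hb.2] at this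
        omega
      · have hua : ¬ u ≤ (a : ℝ) := by rwa [hab]
        push Not at hu hua
        have e1 : |(a : ℝ) - u| + 1 ≤ |(b : ℝ) - u| := by
          rw [abs_of_neg (by linarith), abs_of_neg (by linarith)]; linarith
        have := Nat.floor_le_floor e1
        rw [Nat.floor_add_one (abs_nonneg _), ha.2, hb.2] at this
        omega
  have h := Finset.card_le_card_of_injOn (fun k : ℤ => decide (u ≤ (k : ℝ))) (fun _ _ => Finset.mem_univ _) hinj
  simpa using h

/-- **The shell sum**: for `R ≥ 4`, `u` real and any finite set of integers `K`,
`∑_{k∈K} 1/(M_k √M_k) ≤ 12/√R`, `M_k = max(|k − u|, R)`. [folklore] -/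
theorem sum_inv_max_mul_sqrt_le (K : Finset ℤ) (u : ℝ) {R : ℝ} (hR : 4 ≤ R) :
    ∑ k ∈ K, 1 / (max (|(k : ℝ) - u|) R * Real.sqrt (max (|(k : ℝ) - u|) R)) ≤ 12 / Real.sqrt R := by
  have hR0 : 0 < R := by linarith
  have hsR : 0 < Real.sqrt R := Real.sqrt_pos.2 hR0
  rw [← Finset.sum_filter_add_sum_filter_not K (fun k : ℤ => |(k : ℝ) - u| < R)]
  -- near part
  have hnear : ∑ k ∈ K.filter (fun k : ℤ => |(k : ℝ) - u| < R),
      1 / (max (|(k : ℝ) - u|) R * Real.sqrt (max (|(k : ℝ) - u|) R)) ≤ 3 / Real.sqrt R := by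
    have heq : ∀ k ∈ K.filter (fun k : ℤ => |(k : ℝ) - u| < R),
        1 / (max (|(k : ℝ) - u|) R * Real.sqrt (max (|(k : ℝ) - u|) R)) = 1 / (R * Real.sqrt R) := by
      intro k hk
      rw [Finset.mem_filter] at hk
      rw [max_eq_right hk.2.le]
    rw [Finset.sum_congr rfl heq, Finset.sum_const, nsmul_eq_mul]
    have hc := card_filter_abs_sub_lt_le K u R hR0.le
    calc ((K.filter fun k : ℤ => |(k : ℝ) - u| < R).card : ℝ) * (1 / (R * Real.sqrt R))
        ≤ (3 * R) * (1 / (R * Real.sqrt R)) := by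
          refine mul_le_mul_of_nonneg_right (hc.trans (by linarith)) (by positivity)
      _ = 3 / Real.sqrt R := by field_simp
  -- far part
  have hfar : ∑ k ∈ K.filter (fun k : ℤ => ¬ |(k : ℝ) - u| < R),
      1 / (max (|(k : ℝ) - u|) R * Real.sqrt (max (|(k : ℝ) - u|) R)) ≤ 9 / Real.sqrt R := by
    set G := K.filter (fun k : ℤ => ¬ |(k : ℝ) - u| < R) with hG
    set φ : ℤ → ℕ := fun k => ⌊|(k : ℝ) - u|⌋₊ with hφ
    have hmem : ∀ k ∈ G, R ≤ |(k : ℝ) - u| := fun k hk => by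
      rw [hG, Finset.mem_filter] at hk; push Not at hk; exact hk.2
    -- pointwise: `1/(d √d) ≤ 1/(φ √φ)` with `φ = ⌊d⌋ ≥ 1`
    have hpt : ∀ k ∈ G, 1 / (max (|(k : ℝ) - u|) R * Real.sqrt (max (|(k : ℝ) - u|) R)) ≤
        1 / ((φ k : ℝ) * Real.sqrt (φ k)) := by
      intro k hk
      have hd := hmem k hk
      rw [max_eq_left hd]
      have hφ1 : (1 : ℝ) ≤ φ k := by
        have : 1 ≤ ⌊|(k : ℝ) - u|⌋₊ := Nat.le_floor (by simp; linarith)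
        exact_mod_cast this
      have hφle : (φ k : ℝ) ≤ |(k : ℝ) - u| := Nat.floor_le (abs_nonneg _)
      have h1 : (φ k : ℝ) * Real.sqrt (φ k) ≤ |(k : ℝ) - u| * Real.sqrt (|(k : ℝ) - u|) :=
        mul_le_mul hφle (Real.sqrt_le_sqrt hφle) (Real.sqrt_nonneg _) (abs_nonneg _)
      exact one_div_le_one_div_of_le (by positivity) h1
    refine (Finset.sum_le_sum hpt).trans ?_
    rw [← Finset.sum_fiberwise_of_maps_to (g := φ) (fun k hk => Finset.mem_image_of_mem φ hk)]
    have hfib : ∀ j ∈ G.image φ, ∑ k ∈ G.filter (fun k => φ k = j), 1 / ((φ k : ℝ) * Real.sqrt (φ k)) ≤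
        2 * (1 / ((j : ℝ) * Real.sqrt j)) := by
      intro j _
      have heq : ∀ k ∈ G.filter (fun k => φ k = j), 1 / ((φ k : ℝ) * Real.sqrt (φ k)) = 1 / ((j : ℝ) * Real.sqrt j) := by
        intro k hk; rw [Finset.mem_filter] at hk; rw [hk.2]
      rw [Finset.sum_congr rfl heq, Finset.sum_const, nsmul_eq_mul]
      have hc : ((G.filter (fun k => φ k = j)).card : ℝ) ≤ 2 := by
        exact_mod_cast card_filter_floor_eq_le_two G u j
      exact mul_le_mul_of_nonneg_right hc (by positivity)
    refine (Finset.sum_le_sum hfib).trans ?_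
    rw [← Finset.mul_sum]
    -- the image lies in `[⌊R⌋₊, N]`
    set m := ⌊R⌋₊ with hm
    have hm4 : 4 ≤ m := Nat.le_floor (by simpa using hR)
    obtain ⟨N, hN⟩ : ∃ N : ℕ, ∀ j ∈ G.image φ, j ≤ N := ⟨(G.image φ).sup id, fun j hj => Finset.le_sup (f := id) hj⟩
    have hsub : G.image φ ⊆ Finset.Icc m N := by
      intro j hj
      rw [Finset.mem_Icc]
      refine ⟨?_, hN j hj⟩
      obtain ⟨k, hk, rfl⟩ := Finset.mem_image.1 hj
      exact Nat.floor_le_floor (hmem k hk)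
    have hle : ∑ j ∈ G.image φ, 1 / ((j : ℝ) * Real.sqrt j) ≤ ∑ j ∈ Finset.Icc m N, 1 / ((j : ℝ) * Real.sqrt j) :=
      Finset.sum_le_sum_of_subset_of_nonneg hsub fun j _ _ => by positivity
    have hsum := sum_Icc_inv_mul_sqrt_le (n := N) (show 2 ≤ m by omega)
    -- `√(m − 1) ≥ √(R/2)`: `m − 1 ≥ R − 2 ≥ R/2`
    have hm1 : R / 2 ≤ (m : ℝ) - 1 := by
      have := Nat.lt_floor_add_one R; rw [← hm] at this; linarith
    have hsq : Real.sqrt R ≤ 2 * Real.sqrt ((m : ℝ) - 1) := by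
      rw [show 2 * Real.sqrt ((m : ℝ) - 1) = Real.sqrt (4 * ((m : ℝ) - 1)) by
        rw [Real.sqrt_mul (by norm_num), show Real.sqrt 4 = 2 by
          rw [show (4 : ℝ) = 2 ^ 2 by norm_num, Real.sqrt_sq (by norm_num)]]]
      exact Real.sqrt_le_sqrt (by linarith)
    have hpos : 0 < Real.sqrt ((m : ℝ) - 1) := Real.sqrt_pos.2 (by linarith)
    calc 2 * ∑ j ∈ G.image φ, 1 / ((j : ℝ) * Real.sqrt j) ≤ 2 * (2 / Real.sqrt ((m : ℝ) - 1)) := by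
          linarith
      _ = 4 / Real.sqrt ((m : ℝ) - 1) := by ring
      _ ≤ 9 / Real.sqrt R := by
          rw [div_le_div_iff₀ hpos hsR]; nlinarith
  calc _ ≤ 3 / Real.sqrt R + 9 / Real.sqrt R := add_le_add hnear hfar
    _ = 12 / Real.sqrt R := by ring

/-- `|k| + 2 ≤ (|u| + 2)(|k − u| + 1)`. [folklore] -/
theorem abs_add_two_le (k u : ℝ) : |k| + 2 ≤ (|u| + 2) * (|k - u| + 1) := by
  have h := abs_add_le u (k - u)
  rw [add_sub_cancel] at h
  nlinarith [abs_nonneg u, abs_nonneg (k - u)]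

/-- **The shell estimate with the logarithmic weight**: for `R ≥ 4`,
`∑_{k∈K} log(|k|+2)/max(|k−u|,R)² ≤ 12 (log(|u|+2) + 2)/√R`. [folklore] -/
theorem sum_log_div_max_sq_le (K : Finset ℤ) (u : ℝ) {R : ℝ} (hR : 4 ≤ R) :
    ∑ k ∈ K, Real.log (|(k : ℝ)| + 2) / (max (|(k : ℝ) - u|) R) ^ 2 ≤
      12 * (Real.log (|u| + 2) + 2) / Real.sqrt R := by
  have hlu : 0 ≤ Real.log (|u| + 2) := Real.log_nonneg (by linarith [abs_nonneg u])
  have hpt : ∀ k ∈ K, Real.log (|(k : ℝ)| + 2) / (max (|(k : ℝ) - u|) R) ^ 2 ≤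
      (Real.log (|u| + 2) + 2) * (1 / (max (|(k : ℝ) - u|) R * Real.sqrt (max (|(k : ℝ) - u|) R))) := by
    intro k _
    set M := max (|(k : ℝ) - u|) R with hM
    have hM1 : 1 ≤ M := le_max_of_le_right (by linarith)
    have hM0 : 0 < M := by linarith
    have hsM : 1 ≤ Real.sqrt M := by rw [Real.le_sqrt (by norm_num) hM0.le]; simpa
    -- `log(|k|+2) ≤ log(|u|+2) + log(M + 2) ≤ log(|u|+2) + 2√M`
    have h1 : Real.log (|(k : ℝ)| + 2) ≤ Real.log (|u| + 2) + Real.log (M + 2) := by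
      have hle : |(k : ℝ)| + 2 ≤ (|u| + 2) * (M + 2) := by
        refine (abs_add_two_le (k : ℝ) u).trans ?_
        refine mul_le_mul_of_nonneg_left ?_ (by linarith [abs_nonneg u])
        linarith [le_max_left (|(k : ℝ) - u|) R]
      rw [← Real.log_mul (by linarith [abs_nonneg u]) (by linarith)]
      exact Real.log_le_log (by linarith [abs_nonneg (k : ℝ)]) hle
    have h2 := log_add_two_le_two_sqrt hM1
    set s := Real.sqrt M with hs
    have hs2 : s ^ 2 = M := Real.sq_sqrt hM0.le
    have hMs : M * s = s ^ 3 := by rw [← hs2]; ring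
    have hM2 : M ^ 2 = s ^ 4 := by rw [← hs2]; ring
    rw [hMs, hM2, div_le_iff₀ (by positivity), one_div, show (Real.log (|u| + 2) + 2) * (s ^ 3)⁻¹ * s ^ 4 =
      (Real.log (|u| + 2) + 2) * s by field_simp]
    calc Real.log (|(k : ℝ)| + 2) ≤ Real.log (|u| + 2) + 2 * s := by linarith
      _ ≤ (Real.log (|u| + 2) + 2) * s := by nlinarith
  calc ∑ k ∈ K, Real.log (|(k : ℝ)| + 2) / (max (|(k : ℝ) - u|) R) ^ 2
      ≤ ∑ k ∈ K, (Real.log (|u| + 2) + 2) * (1 / (max (|(k : ℝ) - u|) R * Real.sqrt (max (|(k : ℝ) - u|) R))) :=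
        Finset.sum_le_sum hpt
    _ = (Real.log (|u| + 2) + 2) * ∑ k ∈ K, 1 / (max (|(k : ℝ) - u|) R * Real.sqrt (max (|(k : ℝ) - u|) R)) := by
        rw [Finset.mul_sum]
    _ ≤ (Real.log (|u| + 2) + 2) * (12 / Real.sqrt R) :=
        mul_le_mul_of_nonneg_left (sum_inv_max_mul_sqrt_le K u hR) (by linarith)
    _ = _ := by ring

end Literature.NumberTheory.LFunctions.ZeroOrdinateSums
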